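import Summits.ABC.StewartYu.PadicG3ParG
import HarnessLib

/-!
# The `p`-adic Gen-3 parameter record — v2 CORRECTED closed forms `…V` (R1′: Siegel ÷ g^{n−1}, box = g × multiplicity scale)

Support file (plain definitions and elementary theorems; no named facts), on the SAME structure `PadicG3Par n`;
reuses `g`, `lgg`, `ŜG = SdG`, `yloadG` and their lemmas from `PadicG3ParG` (p489740). It SUPERSEDES the
`LG/Lg/…G` scales of that file (which stay in the tree, unused): plan g8's cheapest falsifier
(STATUS 2026-08-27T03:09:52Z, HOME/plan/m3/b1_check.py) showed that with `L₀G ∝ g^{−n}` the level-0 Siegel count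
is short by the factor `g`, because the level-0 RANGE is `XsG 0 ≍ g·XG/2` (forced by the zeros invariant
`X_s (T_s+1) ≍ 4·g·X·Lg`); repair R1′ = divide the Siegel degree by `g^{n−1}` only (uses the one spare `log p`;
`n ≥ 2` still closes p-uniformly; `n = 1` is the frame-free base of the induction).

THE FAMILY (design HOME/p1/K-M3.2-m0-branch.md §1 as amended by R1′):
* multiplicity scale `LgV = max(⌈24 C_bⁿ Ω K·yloadG/(G·gⁿ)⌉, 2^{n+25}, ⌈(2Amax+1)/g⌉, 4(ŜG+2))` FIRST, then the
  BOX scale `LV = ⌊g·LgV⌋` (so `g·LgV − 1 < LV ≤ g·LgV`: no rounding mismatch between box and multiplicity);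
* `MV = 16(n+1)LgV`, `TV s = max 1 (8LgV/2^s)` (floored), `W_LV`, `XV = max(⌈64(n+1)W_LV/G⌉, ⌈(3/2)(n+1)LgV g^{n−1}/(C_bⁿΩK)⌉, 64(n+1))`,
  `XsV s = ⌊2^s G XV/(16(n+1))⌋ + 1 ≍ 2^{s−1} g XV`, **`L₀V = ⌈6 XV C_bⁿ Ω K/g^{n−1}⌉`**, `HV`, `RV`, `MordV`
  (decrement/level laws), END `D₀V, DV j = ⌊N_q LV/(2^{ŜG}A j)⌋+1, XfinV, S₀NV, κEV`.

## References
* [Nesterenko2003] Yu. V. Nesterenko, LNM 1819 (2003) — (3.23), (4.3)–(4.5), (5.6)–(5.8).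
* [Yu2013] K. Yu, Acta Math. 211 (2013) — §3.1 (3.1)–(3.9), (5.13)–(5.16).
-/

noncomputable section

open Finset Real

namespace Summit.ABC.StewartYu

namespace PadicG3Par

variable {n : ℕ} (P : PadicG3Par n)

/-! ### The scales -/

/-- the MULTIPLICITY scale `LgV = max(⌈24 C_bⁿ Ω K yloadG/(G gⁿ)⌉, 2^{n+25}, ⌈(2Amax+1)/g⌉, 4(ŜG+2))`
(gain-divided; Yu's `D/(θ log p)` unit). [cite: Yu2013, (3.5)] -/
def LgV : ℕ :=
  max (max ⌈24 * Cb ^ n * P.Ω * P.K * P.yloadG / (P.G * P.g ^ n)⌉₊ (2 ^ (n + 25)))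
    (max ⌈(2 * P.Amax + 1) / P.g⌉₊ (4 * (P.SdG + 2)))

/-- the BOX scale `LV = ⌊g · LgV⌋` (Siegel ÷ g^{n−1}). [cite: Yu2013, (3.4)] -/
def LV : ℕ := ⌊P.g * P.LgV⌋₊

/-- the v2 total multiplicity `MV = 16 (n+1) LgV`. [cite: Nesterenko2003, Prop 3.9] -/
def MV : ℕ := 16 * (n + 1) * P.LgV

/-- the v2 decrement `TV s = max 1 (8 LgV/2^s)` — FLOORED at `1`. [cite: Yu2013, (5.15)–(5.16)] -/
def TV (s : ℕ) : ℕ := max 1 (8 * P.LgV / 2 ^ s)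

/-- the v2 size logarithm `W_LG = log(e (1 + 2 e^W LV))`. [cite: Nesterenko2003, (3.37)] -/
def WLV : ℝ := Real.log (Real.exp 1 * (1 + 2 * Real.exp P.W * P.LV))

/-- the v2 number of points `XV = max(⌈64 (n+1) W_LV/G⌉, ⌈(3/2)(n+1) LgV g^{n−1}/(C_bⁿ Ω K)⌉, 64(n+1))`.
[cite: Nesterenko2003, Prop 3.9] -/
def XV : ℕ :=
  max (max ⌈64 * (n + 1) * P.WLV / P.G⌉₊ ⌈(3 / 2) * (n + 1) * P.LgV * P.g ^ (n - 1) / (Cb ^ n * P.Ω * P.K)⌉₊)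
    (64 * (n + 1))

/-- the v2 range at level `s`: `XsV s = ⌊2^s G XV/(16(n+1))⌋ + 1 ≍ 2^{s−1} g XV` (doubling at every level).
[cite: Nesterenko2003, (4.3)] -/
def XsV (s : ℕ) : ℕ := ⌊(2 : ℝ) ^ s * P.G * P.XV / (16 * (n + 1))⌋₊ + 1

/-- the v2 `Y₀`-degree `L₀V = ⌈6 XV C_bⁿ Ω K/g^{n−1}⌉` (Siegel ÷ g^{n−1}, R1′). [cite: Yu2013, (3.7)] -/
def L0V : ℕ := ⌈6 * P.XV * Cb ^ n * P.Ω * P.K / P.g ^ (n - 1)⌉₊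

/-- the v2 Feldman block `HV = max 1 ⌊G XV/(64 (n+1))⌋`. [cite: Nesterenko2003, (3.23)] -/
def HV : ℕ := max 1 ⌊P.G * P.XV / (64 * (n + 1))⌋₊

/-! ### The orders -/

/-- remaining decrements from level `s` to the END: `RV s = Σ_{s' ∈ [s, ŜG]} TV s'`. [cite: Nesterenko2003, (4.5)] -/
def RV (s : ℕ) : ℕ := ∑ s' ∈ Finset.Icc s P.SdG, P.TV s'

/-- the v2 order at stage `(s, ν)`: `MordV s ν = MV/(n+2)³ + (n+1)·RV (s+1) + (n+1−ν)·TV s`.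
[cite: Nesterenko2003, (4.5)] -/
def MordV (s ν : ℕ) : ℕ := P.MV / (n + 2) ^ 3 + (n + 1) * P.RV (s + 1) + (n + 1 - ν) * P.TV s

/-! ### The END data -/

/-- `D₀G = L₀G + 1`. [cite: Nesterenko2003, §5.2] -/
def D0V : ℕ := P.L0V + 1

/-- `DV j = ⌊N_q LV/(2^{ŜG} A j)⌋ + 1`. [cite: Nesterenko2003, §5.2] -/
def DV (j : Fin n) : ℕ := ⌊(P.Nq : ℝ) * P.LV / (2 ^ P.SdG * P.A j)⌋₊ + 1

/-- `XfinV = 2ⁿ XsV ŜG/(n+1)`. [cite: Nesterenko2003, §5.2] -/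
def XfinV : ℕ := 2 ^ n * P.XsV P.SdG / (n + 1)

/-- `S₀NG = MV/(n+2)⁴`. [cite: Nesterenko2003, (5.8)] -/
def S0NV : ℕ := P.MV / (n + 2) ^ 4

/-- the v2 exit-C scale `κEV = 2^{n+25} g/LV`. [cite: Nesterenko2003, §5.2] -/
def κEV : ℝ := 2 ^ (n + 25) * P.g / P.LV

/-! ### Elementary facts: the scales -/


/-- the Siegel term of `LgV`: `24 C_bⁿ Ω K yloadG/(G gⁿ) ≤ LgV`. [folklore] -/
theorem mainV_le_LgV : 24 * Cb ^ n * P.Ω * P.K * P.yloadG / (P.G * P.g ^ n) ≤ P.LgV := by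
  have h : (⌈24 * Cb ^ n * P.Ω * P.K * P.yloadG / (P.G * P.g ^ n)⌉₊ : ℝ) ≤ P.LgV := by
    unfold LgV; exact_mod_cast le_trans (le_max_left _ _) (le_max_left _ _)
  exact (Nat.le_ceil _).trans h

/-- `2^{n+25} ≤ LgV`. [folklore] -/
theorem two_pow_le_LgV : 2 ^ (n + 25) ≤ P.LgV := by
  unfold LgV; exact le_trans (le_max_right _ _) (le_max_left _ _)

/-- `1 ≤ LgV` (real). [folklore] -/
theorem one_le_LgV : (1 : ℝ) ≤ P.LgV := by
  have h : 1 ≤ P.LgV := le_trans Nat.one_le_two_pow P.two_pow_le_LgV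
  exact_mod_cast h

/-- `(2 Amax + 1)/g ≤ LgV`. [folklore] -/
theorem Amax_div_le_LgV : (2 * P.Amax + 1) / P.g ≤ P.LgV := by
  have h : (⌈(2 * P.Amax + 1) / P.g⌉₊ : ℝ) ≤ P.LgV := by
    unfold LgV; exact_mod_cast le_trans (le_max_left _ _) (le_max_right _ _)
  exact (Nat.le_ceil _).trans h

/-- `4 (ŜG + 2) ≤ LgV` (the floor phase's reserve draw is negligible). [folklore] -/
theorem four_SdG_le_LgV : 4 * (P.SdG + 2) ≤ P.LgV := by
  unfold LgV; exact le_trans (le_max_right _ _) (le_max_right _ _)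

/-- `LV ≤ g · LgV`. [folklore] -/
theorem LV_le_g_mul_LgV : (P.LV : ℝ) ≤ P.g * P.LgV := by
  unfold LV; exact Nat.floor_le (by have := P.one_le_g; positivity)

/-- `g · LgV − 1 < LV`. [folklore] -/
theorem LV_gt : P.g * P.LgV - 1 < P.LV := by
  have := Nat.lt_floor_add_one (P.g * P.LgV); unfold LV; linarith

/-- `LV/g ≤ LgV`. [folklore] -/
theorem LV_div_g_le_LgV : (P.LV : ℝ) / P.g ≤ P.LgV := by
  rw [div_le_iff₀ (lt_of_lt_of_le one_pos P.one_le_g)]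
  have := P.LV_le_g_mul_LgV; linarith

/-- `LgV ≤ LV` (as `g ≥ 1`). [folklore] -/
theorem LgV_le_LV : P.LgV ≤ P.LV := by
  unfold LV
  refine Nat.le_floor ?_
  have hg := P.one_le_g
  have hL : (0 : ℝ) ≤ P.LgV := by positivity
  nlinarith

/-- `2^{n+25} ≤ LV`. [folklore] -/
theorem two_pow_le_LV : 2 ^ (n + 25) ≤ P.LV := P.two_pow_le_LgV.trans P.LgV_le_LV

/-- `1 ≤ LV` (real). [folklore] -/
theorem one_le_LV : (1 : ℝ) ≤ P.LV := by
  have h : 1 ≤ P.LV := le_trans Nat.one_le_two_pow P.two_pow_le_LV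
  exact_mod_cast h

/-- `2 Amax ≤ LV` (indeed `2 Amax + 1 ≤ g·LgV < LV + 1`). [folklore] -/
theorem two_Amax_le_LV : 2 * P.Amax ≤ P.LV := by
  have h1 := P.Amax_div_le_LgV
  have hg := lt_of_lt_of_le one_pos P.one_le_g
  rw [div_le_iff₀ hg] at h1
  have h2 := P.LV_gt
  nlinarith

/-- the Siegel term reaches the box: `24 C_bⁿ Ω K yloadG/(G gⁿ) ≤ LV`. [folklore] -/
theorem mainV_le_LV : 24 * Cb ^ n * P.Ω * P.K * P.yloadG / (P.G * P.g ^ n) ≤ P.LV :=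
  P.mainV_le_LgV.trans (by exact_mod_cast P.LgV_le_LV)

/-- `MV = 16 (n+1) LgV`. [folklore] -/
theorem MV_eq : P.MV = 16 * (n + 1) * P.LgV := rfl

/-! ### Elementary facts: the schedule -/

/-- `1 ≤ TV s` at EVERY level (the floor). [cite: Yu2013, (5.15)] -/
theorem one_le_TV (s : ℕ) : 1 ≤ P.TV s := by unfold TV; exact le_max_left _ _

/-- `TV s ≤ 8 LgV`. [folklore] -/
theorem TV_le (s : ℕ) : P.TV s ≤ 8 * P.LgV := by
  unfold TV
  refine max_le ?_ (Nat.div_le_self _ _)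
  have := P.two_pow_le_LgV
  have : 1 ≤ P.LgV := le_trans Nat.one_le_two_pow this
  omega

/-- `8 LgV/2^s ≤ TV s`. [folklore] -/
theorem div_le_TV (s : ℕ) : 8 * P.LgV / 2 ^ s ≤ P.TV s := by unfold TV; exact le_max_right _ _

/-- `1 ≤ XsV s`. [folklore] -/
theorem one_le_XsV (s : ℕ) : 1 ≤ P.XsV s := by unfold XsV; omega

/-- `64 (n+1) ≤ XV`. [folklore] -/
theorem sixtyfour_le_XV : 64 * (n + 1) ≤ P.XV := by unfold XV; exact le_max_right _ _

/-- `64 (n+1) ≤ XV` (real), hence `128 ≤ XV`. [folklore] -/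
theorem sixtyfour_le_XV' : (64 : ℝ) * (n + 1) ≤ P.XV := by exact_mod_cast P.sixtyfour_le_XV

/-- the directional term of `XV`: `64 (n+1) W_LG/G ≤ XV`. [folklore] -/
theorem mainV_le_XV : 64 * (n + 1) * P.WLV / P.G ≤ P.XV := by
  have h : (⌈64 * (n + 1) * P.WLV / P.G⌉₊ : ℝ) ≤ P.XV := by
    unfold XV; exact_mod_cast le_trans (le_max_left _ _) (le_max_left _ _)
  exact (Nat.le_ceil _).trans h

/-- the END term of `XV`: `(3/2)(n+1) LgV g^{n−1}/(C_bⁿ Ω K) ≤ XV`. [folklore] -/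
theorem XE_le_XV : (3 / 2) * (n + 1) * P.LgV * P.g ^ (n - 1) / (Cb ^ n * P.Ω * P.K) ≤ P.XV := by
  have h : (⌈(3 / 2) * (n + 1) * P.LgV * P.g ^ (n - 1) / (Cb ^ n * P.Ω * P.K)⌉₊ : ℝ) ≤ P.XV := by
    unfold XV; exact_mod_cast le_trans (le_max_right _ _) (le_max_left _ _)
  exact (Nat.le_ceil _).trans h

/-- `1 ≤ HV`. [folklore] -/
theorem one_le_HV : 1 ≤ P.HV := by unfold HV; exact le_max_left _ _

/-- `6 XV C_bⁿ Ω K/g^{n−1} ≤ L₀V`. [folklore] -/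
theorem L0V_ge : 6 * P.XV * Cb ^ n * P.Ω * P.K / P.g ^ (n - 1) ≤ P.L0V := by unfold L0V; exact Nat.le_ceil _

/-- `L₀V < 6 XV C_bⁿ Ω K/g^{n−1} + 1`. [folklore] -/
theorem L0V_lt : (P.L0V : ℝ) < 6 * P.XV * Cb ^ n * P.Ω * P.K / P.g ^ (n - 1) + 1 := by
  unfold L0V
  refine Nat.ceil_lt_add_one ?_
  have := P.Ω_pos; have := P.K_pos; have : (0:ℝ) < Cb := by unfold Cb cM; positivity
  have := lt_of_lt_of_le one_pos P.one_le_g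
  positivity

/-! ### The orders: decrement and level laws -/

/-- the in-level decrement law `MordV s ν = MordV s (ν+1) + TV s` for `ν ≤ n`. [cite: Nesterenko2003, (4.5)] -/
theorem MordV_sub_succ (s ν : ℕ) (hν : ν ≤ n) : P.MordV s ν = P.MordV s (ν + 1) + P.TV s := by
  unfold MordV
  have : n + 1 - ν = (n + 1 - (ν + 1)) + 1 := by omega
  rw [this]; ring

/-- `RV s = TV s + RV (s+1)` for `s ≤ ŜG`. [folklore] -/
theorem RV_eq_add (s : ℕ) (hs : s ≤ P.SdG) : P.RV s = P.TV s + P.RV (s + 1) := by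
  unfold RV
  rw [← Finset.sum_Ioc_add_eq_sum_Icc hs, add_comm, Finset.Icc_add_one_left_eq_Ioc]

/-- `RV s = 0` beyond the depth. [folklore] -/
theorem RV_eq_zero (s : ℕ) (hs : P.SdG < s) : P.RV s = 0 := by
  unfold RV; rw [Finset.Icc_eq_empty (by omega), Finset.sum_empty]

/-- the level law `MordV s (n+1) = MordV (s+1) 0` for `s < ŜG` (the Kummer step hands the order over).
[cite: Nesterenko2003, (4.5)] -/
theorem MordV_level (s : ℕ) (hs : s + 1 ≤ P.SdG) : P.MordV s (n + 1) = P.MordV (s + 1) 0 := by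
  unfold MordV
  rw [P.RV_eq_add (s + 1) hs]
  simp only [Nat.sub_self, zero_mul, add_zero, Nat.sub_zero]
  ring

/-- `MV/(n+2)³ ≤ MordV s ν` (the reserved floor, = the END multiplicity). [cite: Nesterenko2003, (4.5)] -/
theorem MV_div_le_MordV (s ν : ℕ) : P.MV / (n + 2) ^ 3 ≤ P.MordV s ν := by
  unfold MordV; omega

/-- `RV 0 ≤ 16 LgV + ŜG + 1` (geometric part `Σ 8Lg/2^s ≤ 16 LgV`, floor part `≤ ŜG + 1`). [folklore] -/
theorem RV_zero_le : P.RV 0 ≤ 16 * P.LgV + (P.SdG + 1) := by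
  unfold RV TV
  have h1 : ∀ s ∈ Finset.Icc 0 P.SdG, max 1 (8 * P.LgV / 2 ^ s) ≤ 1 + 8 * P.LgV / 2 ^ s := by
    intro s _; exact max_le (Nat.le_add_right 1 _) (Nat.le_add_left _ _)
  refine (Finset.sum_le_sum h1).trans ?_
  rw [Finset.sum_add_distrib, Finset.sum_const, Nat.card_Icc, smul_eq_mul, mul_one]
  have h2 : ∑ s ∈ Finset.Icc 0 P.SdG, 8 * P.LgV / 2 ^ s ≤ 16 * P.LgV := by
    have hr : Finset.Icc 0 P.SdG = Finset.range (P.SdG + 1) := by ext s; simp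
    have hreal : ((∑ s ∈ Finset.Icc 0 P.SdG, 8 * P.LgV / 2 ^ s : ℕ) : ℝ) ≤ 16 * P.LgV := by
      rw [Nat.cast_sum]
      have hL : (0 : ℝ) ≤ P.LgV := by positivity
      calc ∑ s ∈ Finset.Icc 0 P.SdG, ((8 * P.LgV / 2 ^ s : ℕ) : ℝ)
          ≤ ∑ s ∈ Finset.Icc 0 P.SdG, (8 * (P.LgV : ℝ)) * (1 / 2) ^ s := by
            refine Finset.sum_le_sum fun s _ => ?_
            calc ((8 * P.LgV / 2 ^ s : ℕ) : ℝ) ≤ ((8 * P.LgV : ℕ) : ℝ) / ((2 ^ s : ℕ) : ℝ) := Nat.cast_div_le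
              _ = (8 * (P.LgV : ℝ)) * (1 / 2) ^ s := by push_cast; rw [one_div, inv_pow]; ring
        _ = (8 * (P.LgV : ℝ)) * ∑ s ∈ Finset.range (P.SdG + 1), (1 / 2 : ℝ) ^ s := by
            rw [← Finset.mul_sum, hr]
        _ ≤ (8 * (P.LgV : ℝ)) * 2 := mul_le_mul_of_nonneg_left (sum_geometric_two_le _) (by positivity)
        _ = 16 * P.LgV := by ring
    exact_mod_cast hreal
  omega

/-- `MordV 0 0 = MV/(n+2)³ + (n+1) RV 0`. [folklore] -/
theorem MordV_zero_zero : P.MordV 0 0 = P.MV / (n + 2) ^ 3 + (n + 1) * P.RV 0 := by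
  unfold MordV
  rw [P.RV_eq_add 0 (Nat.zero_le _)]
  simp only [Nat.sub_zero]
  ring

/-- **`MordV 0 0 ≤ MV/(n+2)³ + (n+1)(16 LgV + ŜG + 1)`** (Nesterenko's `M̂`, gain-divided, plus the floor draw).
[cite: Nesterenko2003, (3.25)] -/
theorem MordV_zero_zero_le : P.MordV 0 0 ≤ P.MV / (n + 2) ^ 3 + (n + 1) * (16 * P.LgV + (P.SdG + 1)) := by
  rw [P.MordV_zero_zero]
  exact Nat.add_le_add_left (Nat.mul_le_mul_left _ P.RV_zero_le) _

end PadicG3Par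

end Summit.ABC.StewartYu
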